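import Summits.HodgeConjecture.HodgeConjecture.Theorems.Ring2WeilCoverageCMFieldNormDescent
import HarnessLib

/-!
# Non-split Weil-type components over quartic CM fields, V: square factors (`[c·v²] = [c]`) — the row `[27]`
# of `ℚ(√-(2+√2))`

research route conditional on HC_CM; not a corollary; Q11.4-sentence-2 already refuted in dim ≥ 3.
Cell `pub-hodge-ring2`, seat `ring2-b03` (gen 47); kernel certificates for the Weil-type family-coverage
census `HOME/WEIL-FAMILY-COVERAGE.md` §b03.5 (operator priority5 2026-08-22T11:46:08Z). The certificates of
gens 46–47 decide classes `[ℓw]` with `ℓ ∤ w` (and, for `ℚ(ζ₅)`, `[c]` with `c ≡ ±2 (5)`); a class `[ℓ³]` such as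
`[27] = [3]·[9]` is reached from `[ℓ]` because SQUARES of `F^×` are norms from the quadratic extension `E/F`
(`[E:F] = 2`, `Deligne1982.finrank_realField_cmField`; `Nm(v) = v²` for `v ∈ F`). §1 records this on Deligne's
carriers (`sq_mem_normUnitsSubgroup_cmField`, `mk_mul_sq_cmNormResidueGroup`, `mk_ne_of_eq_mul_sq`); §2 the
instance `E = ℚ(√-(2+√2))` (`R = S² + 4S + 2`): `[27] ≠ [1]` from gen 46's `[3] ≠ [1]`
(`sqrtNegTwoPlusSqrtTwo_mk_three_ne_splitDiscriminantClassCM`) — the last non-split class `n ≤ 40` of that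
census table not yet in the kernel; with it EVERY non-split class `n ≤ 40` of the `ℚ(√-(2+√2))` table is
kernel-decided.

No named fact, no definition, no `sorry`; nothing about the Hodge conjecture is asserted.
References: [Deligne1982HodgeCycles] §4 p. 30 (1), Cor. 4.2, Lemma 4.6; [Landherr1936HermitianForms]. -/

noncomputable section

set_option linter.dupNamespace false

open Polynomial

namespace Summit.HodgeConjecture.HodgeConjecture.Ring2.WeilCoverageCM

open Literature.AlgebraicGeometry.Deligne1982
open Literature.AlgebraicGeometry.HodgeTheory (splitDiscriminantClassCM)

/-! ### §1 Squares of `F^×` are norms from `E` -/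

section Squares

variable {R : Polynomial ℤ} [Fact (Irreducible (realPolyQ R))] [Fact (Irreducible (cmPolyQ R))]

/-- **`v² ∈ Nm_{E/F}(E^×)` for `v ∈ F^×`** (`[E:F] = 2`, `Nm(v) = v²`). [cite: Deligne1982HodgeCycles, §4 p. 30] -/
theorem sq_mem_normUnitsSubgroup_cmField (v : (realField R)ˣ) :
    v ^ 2 ∈ Literature.AlgebraicGeometry.Motives.normUnitsSubgroup (realField R) (cmField R) := by
  rw [← finrank_realField_cmField (R := R)]
  exact Literature.AlgebraicGeometry.Motives.pow_finrank_mem_normUnitsSubgroup _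

/-- **`[u·v²] = [u]` in `F^×/Nm_{E/F}(E^×)`.** [cite: Deligne1982HodgeCycles, §4 p. 30] -/
theorem mk_mul_sq_cmNormResidueGroup (u v : (realField R)ˣ) :
    (QuotientGroup.mk (u * v ^ 2) : cmNormResidueGroup R) = QuotientGroup.mk u :=
  QuotientGroup.mk_mul_of_mem u (sq_mem_normUnitsSubgroup_cmField v)

/-- Transfer of a non-split certificate along a square factor: if `u = u'·v²` and `[u']` is not the split
class, neither is `[u]`. [cite: Deligne1982HodgeCycles, §4 p. 30 (1) and Cor. 4.2] -/
theorem mk_ne_of_eq_mul_sq {k : ℕ} (u u' v : (realField R)ˣ) (h : u = u' * v ^ 2)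
    (hne : (QuotientGroup.mk u' : cmNormResidueGroup R) ≠ splitDiscriminantClassCM R k) :
    (QuotientGroup.mk u : cmNormResidueGroup R) ≠ splitDiscriminantClassCM R k := by
  rw [h, mk_mul_sq_cmNormResidueGroup]
  exact hne

end Squares

/-! ### §2 Instance `E = ℚ(√-(2+√2))`, `R = S² + 4S + 2`: `[27] = [3]·[3²] ≠ [1]` -/

/-- **`[27w] ≠ [1]` for `E = ℚ(√-(2+√2))`, `3 ∤ w`** (`27w = 3w · 3²`): census row `[27]` (`T = {(√2), (3)}`, like
`[3]`). [cite: Deligne1982HodgeCycles, §4 p. 30 (1) and Cor. 4.2] -/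
theorem sqrtNegTwoPlusSqrtTwo_mk_twentySeven_mul_ne_splitDiscriminantClassCM {R : Polynomial ℤ}
    (hR : R = X ^ 2 + C 4 * X + C 2) [Fact (Irreducible (realPolyQ R))] (w : ℤ) (hw : ¬ (3 : ℤ) ∣ w)
    (u : (realField R)ˣ) (hu : (u : realField R) = AdjoinRoot.of (realPolyQ R) (27 * w)) :
    (QuotientGroup.mk u : cmNormResidueGroup R) ≠ splitDiscriminantClassCM R 2 := by
  haveI : Fact (Irreducible (cmPolyQ R)) := fact_irreducible_cmPolyQ_sqrtNegTwoPlusSqrtTwo hR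
  have h3 : (3 : realField R) ≠ 0 := by
    have h := (AdjoinRoot.of (realPolyQ R)).injective.ne (show (3 : ℚ) ≠ 0 by norm_num)
    rwa [map_ofNat, map_zero] at h
  set v : (realField R)ˣ := Units.mk0 (3 : realField R) h3 with hv
  have hu' : ((u * (v ^ 2)⁻¹ : (realField R)ˣ) : realField R) = AdjoinRoot.of (realPolyQ R) (3 * w) := by
    rw [Units.val_mul, Units.val_inv_eq_inv_val, Units.val_pow_eq_pow_val, hv, Units.val_mk0, hu, map_mul, map_mul,
      map_ofNat, map_ofNat]
    field_simp
    ring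
  refine mk_ne_of_eq_mul_sq u (u * (v ^ 2)⁻¹) v (by rw [inv_mul_cancel_right]) ?_
  exact sqrtNegTwoPlusSqrtTwo_mk_three_mul_ne_splitDiscriminantClassCM hR w hw _ hu'

/-- **`[27] ≠ [1]` for `ℚ(√-(2+√2))`** with `R = S² + 4S + 2` LITERALLY: the last non-split class `n ≤ 40` of that
census table outside the odd-unramified-prime criteria (`27 = 3³`); with gens 46–47 every non-split class
`n ≤ 40` of the `ℚ(√-(2+√2))` table is kernel-decided. [cite: Deligne1982HodgeCycles, §4 p. 30 (1) and Cor. 4.2] -/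
theorem sqrtNegTwoPlusSqrtTwo_twentySeven_nonsplit :
    haveI := fact_irreducible_realPolyQ_sqrtTwo (R := X ^ 2 + C 4 * X + C 2) rfl
    ∀ u : (realField (X ^ 2 + C 4 * X + C 2))ˣ, (u : realField (X ^ 2 + C 4 * X + C 2)) = 27 →
      (QuotientGroup.mk u : cmNormResidueGroup (X ^ 2 + C 4 * X + C 2)) ≠
        splitDiscriminantClassCM (X ^ 2 + C 4 * X + C 2) 2 := by
  haveI := fact_irreducible_realPolyQ_sqrtTwo (R := X ^ 2 + C 4 * X + C 2) rfl
  exact fun u hu => sqrtNegTwoPlusSqrtTwo_mk_twentySeven_mul_ne_splitDiscriminantClassCM rfl 1 (by norm_num) u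
    (by rw [hu]; norm_num)

end Summit.HodgeConjecture.HodgeConjecture.Ring2.WeilCoverageCM

end
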